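import Literature.AlgebraicGeometry.Morphisms.CechModuleShortExact
import Literature.AlgebraicGeometry.Morphisms.CechModuleBiproduct
import Literature.AlgebraicGeometry.Morphisms.CohOfVectorBundle
import Literature.AlgebraicGeometry.Modules.SheafHomExact
import Literature.AlgebraicGeometry.Modules.SheafHomCoh
import Literature.AlgebraicGeometry.Modules.SheafHomLeft
import Literature.AlgebraicGeometry.Modules.AffineLocalizingClosure
import Literature.AlgebraicGeometry.Modules.LocalFrames
import Mathlib.Algebra.Homology.ShortComplex.ShortExact
import Mathlib.CategoryTheory.Limits.Shapes.Biproducts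
import HarnessLib

/-!
# `Ȟ¹` and the internal Hom `𝓗om_{𝒪_X}(E, –)` in the SECOND variable: biproducts, exactness for
# `E` finite locally free, the Čech exactness data of `𝓗om(E, 0 → M' → M → M'' → 0)`, and the
# surjectivity of the connecting homomorphism

Sequel of `Modules/SheafHomLeft` (the same bookkeeping in the first variable) and of
`Morphisms/CechModuleExact`, `Morphisms/CechModuleShortExact`, `Morphisms/CechModuleBiproduct`. For a scheme
`f : X → Spec A`, a family of opens `𝒰` and `𝒪_X`-modules `E, M, N`:

* `subsingleton_cechMH1_biprod` — `Ȟ¹(𝒰, M ⊞ N) = 0` if `Ȟ¹(𝒰, M) = Ȟ¹(𝒰, N) = 0` (binary form of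
  `subsingleton_cechMH1_biproduct`);
* `sheafHomMap_biprod_total`, **`subsingleton_cechMH1_sheafHom_biprod_right`**,
  `subsingleton_cechMH1_sheafHom_biproduct_right`, `…_of_isZero_right`, `…_initial_right`,
  `…_of_iso_right`, `…_of_iso_biproduct_unit_right` — `Ȟ¹(𝒰, 𝓗om(E, –))` vanishes on zero objects and
  on (binary, finite) biproducts of modules on which it vanishes; in particular on every `P ≅ ⨁_I 𝒪_X`
  (`I` finite) as soon as `Ȟ¹(𝒰, E^∨) = 0`, `E^∨ = 𝓗om(E, 𝒪_X)` (`Modules/LocalFrames`, `dual`). The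
  functor `𝓗om(E, –)` being additive (`Modules/SheafHomFunctor`), this is the biproduct identity
  `π₁ι₁ + π₂ι₂ = 𝟙` transported through it and through the additive `Ȟ¹(𝒰, –)`
  (The Stacks Project, Tag 01ED: the Čech complex is functorial — indeed additive — in the sheaf);
* **`shortExact_map_sheafHomFunctor`** — for `E` FINITE LOCALLY FREE, `𝓗om(E, –)` carries short exact
  sequences to short exact sequences (it preserves finite limits for every `E` and finite colimits for
  `E` finite locally free, `Modules/SheafHomExact`; Hartshorne III, proof of Prop. 6.5: "`𝓗om(𝓛, –)` is
  exact for `𝓛` locally free of finite rank");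
* **`CechExactData.sheafHom_of_shortExact`**, `CechExactData.sheafHom_kernel` (+ `_of_coh` forms on a
  locally noetherian `X`) — hence `0 → 𝓗om(E, M') → 𝓗om(E, M) → 𝓗om(E, M'') → 0`, resp.
  `0 → 𝓗om(E, ker q) → 𝓗om(E, P) → 𝓗om(E, N) → 0` for an epimorphism `q : P → N`, carries the
  sectionwise exactness data of `Morphisms/CechModuleExact` on every family of AFFINE opens once
  `𝓗om(E, M')` is affine-localizing (automatic for `E` finite locally free and `M'` affine-localizing on
  a locally noetherian `X`, `Modules/SheafHomCoh`), so the long exact Čech sequence in degrees `≤ 1`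
  applies to it — WITHOUT any separate surjectivity hypothesis on affine sections (Hartshorne II
  Prop. 5.6, `Morphisms/CechModuleShortExact`);
* **`CechExactData.cechDelta_surjective_of_subsingleton`** — if `Ȟ¹(𝒰, M) = 0` then the connecting
  homomorphism `δ : Ȟ⁰(𝒰, M'') → Ȟ¹(𝒰, M')` is onto (exactness at `Ȟ¹(M')`,
  `CechExactData.exists_cechDelta_eq`); `CechExactData.cechDelta_surjective_sheafHom_of_iso_biproduct_unit`
  — the form used for a presentation `q : 𝒪_X^N ↠ E` of a finite locally free `E` with
  `Ȟ¹(𝒰, E^∨) = 0`: `δ : Ȟ⁰(𝒰, 𝓔nd E) → Ȟ¹(𝒰, 𝓗om(E, ker q))` is onto.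

These are the two Čech plumbing steps ("A3", "A6") of the identification
`End̲_T(M) ≃ Ȟ¹(𝒰, 𝓗om(M~, 𝒦))` for full sheaves on a resolution of a two-dimensional normal local
ring (Artin–Verdier 1985, proof of Thm. 1.11; cell res-hironaka, chain W4.4, crux `NoZenoR`
stmt-ResolutionOfSingularities-19943, G2), stated for arbitrary schemes. Everything is proved; no named
facts. Mathlib searched (pin v4.32): `ShortComplex.ShortExact.map_of_exact`, `Functor.map_isZero`,
`Functor.mapIso`, `biprod.total`, `IsBilimit.total`, `HasZeroObject.zeroIsoInitial` (used); Mathlib has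
no Čech cohomology of sheaves of modules on schemes (cf. `Morphisms/CechModule`).

## References

* R. Hartshorne, *Algebraic Geometry*, GTM 52, Springer (1977): II Prop. 5.6 (p. 113); III, proof of
  Thm. 4.5 (p. 222); III, proof of Prop. 6.5 (p. 234). [Hartshorne1977]
* The Stacks Project, Tag 01ED (Cohomology, Section 20.9: the Čech complex and its functoriality).
  [StacksProject]
* M. Artin, J.-L. Verdier, *Reflexive modules over rational double points*, Math. Ann. 270 (1985)
  79–82: proof of Thm. 1.11 (context). [ArtinVerdier1985]
-/

noncomputable section

open CategoryTheory AlgebraicGeometry Limits TopologicalSpace Opposite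
open Literature.AlgebraicGeometry.Modules Literature.AlgebraicGeometry.Motives

universe u v w

namespace Literature.AlgebraicGeometry.Morphisms

variable {A : Type u} [CommRing A] {X : Scheme.{u}} (f : X ⟶ Spec (.of A)) {ι : Type v}
  (U : ι → X.Opens)

/-! ## `Ȟ¹` of binary biproducts; `Ȟ¹(𝒰, 𝓗om(E, –))` on zero objects, biproducts, isomorphic modules -/

/-- **`Ȟ¹(𝒰, M ⊞ N) = 0` if `Ȟ¹(𝒰, M) = 0` and `Ȟ¹(𝒰, N) = 0`**: every class `x` equals
`Ȟ¹(ι₁)(Ȟ¹(π₁) x) + Ȟ¹(ι₂)(Ȟ¹(π₂) x)` (`biprod.total`) and the inner classes vanish.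
[cite: StacksProject, Tag 01ED (Cohomology, Section 20.9)] -/
theorem subsingleton_cechMH1_biprod (M N : X.Modules) (hM : Subsingleton (CechMH1 f M U))
    (hN : Subsingleton (CechMH1 f N U)) : Subsingleton (CechMH1 f (M ⊞ N) U) := by
  refine subsingleton_of_forall_eq 0 fun x => ?_
  have h₁ : cechMapH1 f (biprod.fst : M ⊞ N ⟶ M) U x = 0 := Subsingleton.elim _ _
  have h₂ : cechMapH1 f (biprod.snd : M ⊞ N ⟶ N) U x = 0 := Subsingleton.elim _ _
  rw [← cechMapH1_id_apply f U x, ← biprod.total, cechMapH1_add_apply, cechMapH1_comp,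
    cechMapH1_comp, h₁, h₂, map_zero, map_zero, add_zero]

/-- The biproduct identity transported through `𝓗om(E, –)`:
`𝓗om(E, π₁) ≫ 𝓗om(E, ι₁) + 𝓗om(E, π₂) ≫ 𝓗om(E, ι₂) = 𝟙_{𝓗om(E, M ⊞ N)}` (`𝓗om(E, –)` is an
additive functor). [cite: Hartshorne1977, II Ex. 1.15 and II.5 p. 109] -/
lemma sheafHomMap_biprod_total (E M N : X.Modules) :
    sheafHomMap E (biprod.fst : M ⊞ N ⟶ M) ≫ sheafHomMap E biprod.inl +
      sheafHomMap E (biprod.snd : M ⊞ N ⟶ N) ≫ sheafHomMap E biprod.inr = 𝟙 _ := by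
  rw [← sheafHomMap_comp, ← sheafHomMap_comp, ← sheafHomMap_add, biprod.total, sheafHomMap_id]

/-- **`Ȟ¹` vanishing for `𝓗om` into a binary biproduct.** If `Ȟ¹(𝒰, 𝓗om(E, M)) = 0` and
`Ȟ¹(𝒰, 𝓗om(E, N)) = 0` then `Ȟ¹(𝒰, 𝓗om(E, M ⊞ N)) = 0`: every class `x` equals
`Ȟ¹(𝓗om(E, ι₁))(Ȟ¹(𝓗om(E, π₁)) x) + Ȟ¹(𝓗om(E, ι₂))(Ȟ¹(𝓗om(E, π₂)) x)` by
`sheafHomMap_biprod_total`, and the inner classes vanish.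
[cite: StacksProject, Tag 01ED (Cohomology, Section 20.9)] -/
theorem subsingleton_cechMH1_sheafHom_biprod_right (E M N : X.Modules)
    (hM : Subsingleton (CechMH1 f (sheafHom E M) U))
    (hN : Subsingleton (CechMH1 f (sheafHom E N) U)) :
    Subsingleton (CechMH1 f (sheafHom E (M ⊞ N)) U) := by
  refine subsingleton_of_forall_eq 0 fun x => ?_
  have h₁ : cechMapH1 f (sheafHomMap E (biprod.fst : M ⊞ N ⟶ M)) U x = 0 := Subsingleton.elim _ _
  have h₂ : cechMapH1 f (sheafHomMap E (biprod.snd : M ⊞ N ⟶ N)) U x = 0 := Subsingleton.elim _ _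
  rw [← cechMapH1_id_apply f U x, ← sheafHomMap_biprod_total, cechMapH1_add_apply, cechMapH1_comp,
    cechMapH1_comp, h₁, h₂, map_zero, map_zero, add_zero]

/-- **`Ȟ¹` vanishing for `𝓗om` into a finite biproduct**: if `Ȟ¹(𝒰, 𝓗om(E, Fⱼ)) = 0` for all `j`
then `Ȟ¹(𝒰, 𝓗om(E, ⨁ⱼ Fⱼ)) = 0` (`∑ⱼ πⱼ ιⱼ = 𝟙` transported through the additive functor
`𝓗om(E, –)` and through `Ȟ¹`). [cite: StacksProject, Tag 01ED (Cohomology, Section 20.9)] -/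
theorem subsingleton_cechMH1_sheafHom_biproduct_right (E : X.Modules) {J : Type w} [Finite J]
    (F : J → X.Modules) [HasBiproduct F]
    (hF : ∀ j, Subsingleton (CechMH1 f (sheafHom E (F j)) U)) :
    Subsingleton (CechMH1 f (sheafHom E (⨁ F)) U) := by
  classical
  cases nonempty_fintype J
  refine subsingleton_of_forall_eq 0 fun x => ?_
  have hzero : ∀ j, cechMapH1 f (sheafHomMap E (biproduct.π F j)) U x = 0 := fun j =>
    Subsingleton.elim _ _
  have htot : ∑ j, biproduct.π F j ≫ biproduct.ι F j = 𝟙 (⨁ F) :=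
    Limits.IsBilimit.total (biproduct.isBilimit F)
  have hsum : ∑ j, sheafHomMap E (biproduct.π F j) ≫ sheafHomMap E (biproduct.ι F j) =
      sheafHomMap E (∑ j, biproduct.π F j ≫ biproduct.ι F j) := by
    rw [show sheafHomMap E (∑ j, biproduct.π F j ≫ biproduct.ι F j) =
        ∑ j, sheafHomMap E (biproduct.π F j ≫ biproduct.ι F j) from (sheafHomFunctor E).map_sum _ _]
    exact Finset.sum_congr rfl fun j _ => (sheafHomMap_comp E _ _).symm
  have htot' : ∑ j, sheafHomMap E (biproduct.π F j) ≫ sheafHomMap E (biproduct.ι F j) =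
      𝟙 (sheafHom E (⨁ F)) := by
    rw [hsum, htot, sheafHomMap_id]
  rw [← cechMapH1_id_apply f U x, ← htot', cechMapH1_sum_apply]
  refine Finset.sum_eq_zero fun j _ => ?_
  rw [cechMapH1_comp, hzero j, map_zero]

/-- `Ȟ¹(𝒰, 𝓗om(E, N)) = 0` for a zero module `N` (`𝓗om(E, –)` is additive, so `𝓗om(E, N)` is a
zero object, and the Čech complex is additive in the sheaf).
[cite: StacksProject, Tag 01ED (Cohomology, Section 20.9)] -/
theorem subsingleton_cechMH1_sheafHom_of_isZero_right (E : X.Modules) {N : X.Modules}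
    (hN : IsZero N) : Subsingleton (CechMH1 f (sheafHom E N) U) :=
  subsingleton_cechMH1_of_isZero f U ((sheafHomFunctor E).map_isZero hN)

/-- `Ȟ¹(𝒰, 𝓗om(E, ⊥)) = 0` for the initial `𝒪_X`-module `⊥` (a zero object).
[cite: StacksProject, Tag 01ED (Cohomology, Section 20.9)] -/
theorem subsingleton_cechMH1_sheafHom_initial_right (E : X.Modules) :
    Subsingleton (CechMH1 f (sheafHom E (⊥_ X.Modules)) U) :=
  subsingleton_cechMH1_sheafHom_of_isZero_right f U E
    ((isZero_zero X.Modules).of_iso HasZeroObject.zeroIsoInitial.symm)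

/-- `Ȟ¹(𝒰, 𝓗om(E, –))` vanishing is invariant under isomorphism of the second variable: if `M ≅ N`
and `Ȟ¹(𝒰, 𝓗om(E, N)) = 0` then `Ȟ¹(𝒰, 𝓗om(E, M)) = 0` (functoriality of the Čech complex in the
sheaf). [cite: StacksProject, Tag 01ED (Cohomology, Section 20.9)] -/
theorem subsingleton_cechMH1_sheafHom_of_iso_right (E : X.Modules) {M N : X.Modules} (e : M ≅ N)
    (h : Subsingleton (CechMH1 f (sheafHom E N) U)) :
    Subsingleton (CechMH1 f (sheafHom E M) U) :=
  subsingleton_cechMH1_of_iso f U ((sheafHomFunctor E).mapIso e) h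

/-- **`Ȟ¹(𝒰, 𝓗om(E, P)) = 0` for `P ≅ ⨁_I 𝒪_X` (`I` finite) as soon as `Ȟ¹(𝒰, E^∨) = 0`**, where
`E^∨ = 𝓗om(E, 𝒪_X)` (`dual E`). [cite: StacksProject, Tag 01ED (Cohomology, Section 20.9)] -/
theorem subsingleton_cechMH1_sheafHom_of_iso_biproduct_unit_right (E : X.Modules) {P : X.Modules}
    {I : Type w} [Finite I] [HasBiproduct fun _ : I => unitModule X]
    (e : P ≅ ⨁ fun _ : I => unitModule X) (hdual : Subsingleton (CechMH1 f (dual E) U)) :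
    Subsingleton (CechMH1 f (sheafHom E P) U) :=
  subsingleton_cechMH1_sheafHom_of_iso_right f U E e
    (subsingleton_cechMH1_sheafHom_biproduct_right f U E _ fun _ => hdual)

/-! ## Exactness of `𝓗om(E, –)` for `E` finite locally free; the Čech exactness data -/

/-- **`𝓗om(E, –)` is exact for `E` finite locally free**: it carries a short exact sequence
`0 → M' → M → M'' → 0` of `𝒪_X`-modules to the short exact sequence
`0 → 𝓗om(E, M') → 𝓗om(E, M) → 𝓗om(E, M'') → 0` (finite limits are preserved for every `E`, finite
colimits for `E` finite locally free: `Modules/SheafHomExact`).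
[cite: Hartshorne1977, III Prop. 6.5 proof (p. 234)] -/
theorem shortExact_map_sheafHomFunctor (E : X.Modules) (hE : IsFiniteLocallyFree E)
    {S : ShortComplex X.Modules} (hS : S.ShortExact) : (S.map (sheafHomFunctor E)).ShortExact := by
  haveI := preservesFiniteColimits_sheafHomFunctor E hE
  exact hS.map_of_exact (sheafHomFunctor E)

namespace CechExactData

/-- **The Čech exactness data of `𝓗om(E, 0 → M' → M → M'' → 0)` on affine opens**: for `E` finite
locally free, `0 → M' → M → M'' → 0` short exact and `𝓗om(E, M')` affine-localizing (e.g. `X` locally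
noetherian and `M'` affine-localizing, `sheafHom_of_shortExact_of_isAffineLocalizing`), the sequence
`𝓗om(E, M') → 𝓗om(E, M) → 𝓗om(E, M'')` is exact on sections over every open and `𝓗om(E, M) → 𝓗om(E, M'')`
is onto on the sections over every AFFINE `U_i` — no separate surjectivity hypothesis is needed.
[cite: Hartshorne1977, II Prop. 5.6 (p. 113) with III Prop. 6.5 proof (p. 234)] -/
theorem sheafHom_of_shortExact (E : X.Modules) (hE : IsFiniteLocallyFree E)
    {S : ShortComplex X.Modules} (hS : S.ShortExact) (h₁ : IsAffineLocalizing (sheafHom E S.X₁))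
    (hU : ∀ i, IsAffineOpen (U i)) : CechExactData f U (sheafHomMap E S.f) (sheafHomMap E S.g) :=
  CechExactData.of_shortExact f U (shortExact_map_sheafHomFunctor E hE hS) h₁ hU

/-- The same with the affine-localizing hypothesis placed on `M'` itself, on a locally noetherian `X`
(`𝓗om(E, M')` is then affine-localizing: `E` is coherent as a finite locally free module,
`Modules/SheafHomCoh`). [cite: Hartshorne1977, II Prop. 5.6 (p. 113) with III Prop. 6.5 proof (p. 234)] -/
theorem sheafHom_of_shortExact_of_isAffineLocalizing [IsLocallyNoetherian X] (E : X.Modules)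
    (hE : IsFiniteLocallyFree E) {S : ShortComplex X.Modules} (hS : S.ShortExact)
    (h₁ : IsAffineLocalizing S.X₁) (hU : ∀ i, IsAffineOpen (U i)) :
    CechExactData f U (sheafHomMap E S.f) (sheafHomMap E S.g) :=
  sheafHom_of_shortExact f U E hE hS
    (isAffineLocalizing_sheafHom hE.isVectorBundle.coh.loc hE.isVectorBundle.coh.ft h₁) hU

/-- **The Čech exactness data of `0 → 𝓗om(E, ker q) → 𝓗om(E, P) → 𝓗om(E, N) → 0`** for an
epimorphism `q : P → N` of `𝒪_X`-modules, `E` finite locally free and `𝓗om(E, ker q)`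
affine-localizing, on every family of affine opens.
[cite: Hartshorne1977, II Prop. 5.6 (p. 113) with III Prop. 6.5 proof (p. 234)] -/
theorem sheafHom_kernel (E : X.Modules) (hE : IsFiniteLocallyFree E) {P N : X.Modules} (q : P ⟶ N)
    [Epi q] (h₁ : IsAffineLocalizing (sheafHom E (kernel q))) (hU : ∀ i, IsAffineOpen (U i)) :
    CechExactData f U (sheafHomMap E (kernel.ι q)) (sheafHomMap E q) :=
  sheafHom_of_shortExact f U E hE (S := ShortComplex.mk (kernel.ι q) q (kernel.condition q))
    (ShortComplex.ShortExact.mk' (ShortComplex.exact_of_f_is_kernel _ (kernelIsKernel q))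
      inferInstance inferInstance) h₁ hU

/-- The same with the affine-localizing hypotheses placed on `P` and `N`, on a locally noetherian `X`
(`ker q` is then affine-localizing, `Modules/AffineLocalizingClosure`, and so is `𝓗om(E, ker q)`).
[cite: Hartshorne1977, II Prop. 5.6 (p. 113) with III Prop. 6.5 proof (p. 234)] -/
theorem sheafHom_kernel_of_isAffineLocalizing [IsLocallyNoetherian X] (E : X.Modules)
    (hE : IsFiniteLocallyFree E) {P N : X.Modules} (q : P ⟶ N) [Epi q] (hP : IsAffineLocalizing P)
    (hN : IsAffineLocalizing N) (hU : ∀ i, IsAffineOpen (U i)) :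
    CechExactData f U (sheafHomMap E (kernel.ι q)) (sheafHomMap E q) :=
  sheafHom_kernel f U E hE q
    (isAffineLocalizing_sheafHom hE.isVectorBundle.coh.loc hE.isVectorBundle.coh.ft
      (IsAffineLocalizing.kernel q hP hN)) hU

/-! ## Surjectivity of the connecting homomorphism -/

variable {f U} {M' M M'' : X.Modules} {φ : M' ⟶ M} {ψ : M ⟶ M''}

/-- **If `Ȟ¹(𝒰, M) = 0` then `δ : Ȟ⁰(𝒰, M'') → Ȟ¹(𝒰, M')` is surjective** (exactness of the long Čech
sequence at `Ȟ¹(M')`: every class mapping to `0` in `Ȟ¹(M)` is a value of `δ`).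
[cite: Hartshorne1977, III Thm. 4.5 proof p. 222 (long exact sequence of Čech cohomology)] -/
theorem cechDelta_surjective_of_subsingleton (h : CechExactData f U φ ψ)
    (hM : Subsingleton (CechMH1 f M U)) : Function.Surjective h.cechDelta := fun y =>
  h.exists_cechDelta_eq y (Subsingleton.elim _ _)

/-- **`δ : Ȟ⁰(𝒰, 𝓗om(E, N)) → Ȟ¹(𝒰, 𝓗om(E, ker q))` is onto for a presentation `q : P ↠ N` with
`P ≅ ⨁_I 𝒪_X` (`I` finite) and `Ȟ¹(𝒰, E^∨) = 0`** (for any Čech exactness data of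
`𝓗om(E, ker q) → 𝓗om(E, P) → 𝓗om(E, N)`, e.g. `sheafHom_kernel`): `Ȟ¹(𝒰, 𝓗om(E, P)) = 0` by
`subsingleton_cechMH1_sheafHom_of_iso_biproduct_unit_right`.
[cite: Hartshorne1977, III Thm. 4.5 proof p. 222 (long exact sequence of Čech cohomology)] -/
theorem cechDelta_surjective_sheafHom_of_iso_biproduct_unit (E : X.Modules) {P N : X.Modules}
    {q : P ⟶ N} (h : CechExactData f U (sheafHomMap E (kernel.ι q)) (sheafHomMap E q))
    {I : Type w} [Finite I] [HasBiproduct fun _ : I => unitModule X]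
    (e : P ≅ ⨁ fun _ : I => unitModule X) (hdual : Subsingleton (CechMH1 f (dual E) U)) :
    Function.Surjective h.cechDelta :=
  h.cechDelta_surjective_of_subsingleton
    (subsingleton_cechMH1_sheafHom_of_iso_biproduct_unit_right f U E e hdual)

end CechExactData

end Literature.AlgebraicGeometry.Morphisms

end
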